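import Summits.ResolutionOfSingularities.ResolutionOfSingularities.Theorems.FrobeniusClosingPatchingRelPerfectDepthMultiHostFormatSnc
import Literature.AlgebraicGeometry.Resolution.StrictNormalCrossingsLabels
import Literature.AlgebraicGeometry.Resolution.KollarMaxContactPersistence
import HarnessLib

/-!
# Crux `PatchingRelPerfect` (stmt-ResolutionOfSingularities-16161), chain W5.2 — F7(β) (β-AX) X3 C-I, (L0): THE LETTER-PATCH ADAPTER
# (`…DepthPhaseCLetterPatch`)

[OURS · L1 W5.2 · F7(β) (β-AX) X3 C-I · res-L1-w52-plan-1 RULING G12-20 (2), hand res-D-repro-1 AS res-L1-repro-3] The PRODUCER of the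
hypotheses of res-D-pv-046΄s CE1 / (C0) lifts (`DepthMultiHost.carrierGameLift` p561817, `monomialPatchLift`) from EQUATION-LEVEL data on a
patch, so that the (M2a) LMR dictionary (res-L1-w52-idea-1, stalk-level at a point) only has to deliver letters, labels and exponents: on a
scheme `U` (the patch, or the carrier), LETTERS `L : Fin k → U.IdealSheafData` carrying POINTWISE rsop LABELS (at each point `x` the stalks of
the letters through `x` are generated by distinct members of one part of a regular system of parameters — the datum of the tree΄s
`hasSNC_of_isRsopPart_labels`, INDEX-labelled) and exponent ROWS `a : Fin s → Fin k → ℕ`, `s ≠ 0`, with the ideal-sheaf equation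
`K = ⨆ t, ∏ j, L j ^ a t j` ⟹ **`∃ 𝓛 𝒦, HasSNC 𝓛 ∧ 𝓛.Nodup ∧ 𝒦 ≠ [] ∧ (∀ A ∈ 𝒦, boundaryOf A = 𝓛) ∧ K = monomialSum 𝒦`** — EXACTLY the
binder types of `carrierGameLift` — with `𝓛` = the distinct non-unit letters (`⊤`-letters dropped, repeated letters merged: the exponent of a
letter `T` in row `t` is `Σ_{j : L j = T} a t j`), every member of `𝓛` one of the `L j`, and every non-unit `L j` a member of `𝓛`.
Def-free; NOT a statement of the manuscript under review; AI-written, weaker than expert review.  Mathlib + landed W5.2 files only; no fact, no sorry.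

## References
* E. Bierstone, D. Grigoriev, P. Milman, J. Włodarczyk, *Effective Hironaka resolution …* (2011), Def. 3.1.1 (snc via regular parameters),
  §4 Step 2 (monomial ideals in an snc family). [BierstoneGrigorievMilmanWlodarczyk2011]
* J. Kollár, *Lectures on Resolution of Singularities* (2007), (3.111) Step 3. [Kollar2007]
-/

-- `Summit.<Summit>.<Sub>.Theorems` with `Sub = Summit` (single-conjunct summit, D-0017)
set_option linter.dupNamespace false

noncomputable section

open CategoryTheory AlgebraicGeometry TopologicalSpace IsLocalRing
open Literature.AlgebraicGeometry.Resolution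
open Scheme.IdealSheafData

namespace Summit.ResolutionOfSingularities.ResolutionOfSingularities.Theorems.DepthMultiHost

universe u

variable {U : Scheme.{u}}

/-! ## §1 Index-labelled letters have simple normal crossings -/

/-- [OURS · L1 W5.2 · (L0)] **INDEX-labelled rsop data give `HasSNC` for the list of letters** (the tree΄s `hasSNC_of_isRsopPart_labels` wants
labels on the MEMBER subtype; an index label is transported along any choice of index for a member). [cite: BierstoneGrigorievMilmanWlodarczyk2011, Def. 3.1.1] -/
theorem hasSNC_ofFn_of_isRsopPart_labels {k : ℕ} (L : Fin k → U.IdealSheafData)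
    (hlab : ∀ x : U, ∃ (m : ℕ) (z : Fin m → U.presheaf.stalk x), IsRsopPart z ∧
      ∃ ι : {j : Fin k // x ∈ (L j).support} → Fin m, Function.Injective ι ∧ ∀ j, stalkIdeal (L j.1) x = Ideal.span {z (ι j)}) :
    HasSNC (List.ofFn L) := by
  classical
  refine hasSNC_of_isRsopPart_labels _ fun x => ?_
  obtain ⟨m, z, hz, ι, hι, hιL⟩ := hlab x
  have hidx : ∀ D : {D : U.IdealSheafData // D ∈ List.ofFn L ∧ x ∈ D.support}, ∃ j : Fin k, L j = D.1 :=
    fun D => List.mem_ofFn.mp D.2.1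
  choose jOf hjOf using hidx
  have hmem : ∀ D : {D : U.IdealSheafData // D ∈ List.ofFn L ∧ x ∈ D.support}, x ∈ (L (jOf D)).support :=
    fun D => by rw [hjOf]; exact D.2.2
  refine ⟨m, z, hz, fun D => ι ⟨jOf D, hmem D⟩, fun D₁ D₂ h => ?_, fun D => ?_⟩
  · have h1 : jOf D₁ = jOf D₂ := congrArg Subtype.val (hι h)
    exact Subtype.ext (by rw [← hjOf D₁, ← hjOf D₂, h1])
  · rw [← hιL ⟨jOf D, hmem D⟩, hjOf]

/-! ## §2 Regrouping a product of letter powers along the distinct letters -/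

/-- [OURS · L1 W5.2 · (L0)] **Regrouping**: `∏ j, L j ^ a j = ∏_{T ∈ (image L) ∖ {⊤}} T ^ (Σ_{j : L j = T} a j)`. [folklore] -/
theorem prod_pow_eq_prod_image_erase_top [DecidableEq U.IdealSheafData] {k : ℕ} (L : Fin k → U.IdealSheafData) (a : Fin k → ℕ) :
    ∏ j, L j ^ a j = ∏ T ∈ (Finset.univ.image L).erase ⊤, T ^ (∑ j ∈ Finset.univ.filter (fun j => L j = T), a j) := by
  rw [Finset.prod_erase _ (by rw [← one_eq_top, one_pow])]
  rw [← Finset.prod_fiberwise_of_maps_to (g := L) (fun j _ => Finset.mem_image_of_mem L (Finset.mem_univ j))]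
  refine Finset.prod_congr rfl fun T _ => ?_
  rw [← Finset.prod_pow_eq_pow_sum]
  refine Finset.prod_congr rfl fun j hj => ?_
  rw [(Finset.mem_filter.mp hj).2]

/-! ## §3 The adapter -/

/-- [OURS · L1 W5.2 · F7(β) (β-AX) X3 C-I (L0) · res-L1-w52-plan-1 RULING G12-20 (2)] **THE LETTER-PATCH ADAPTER.**  Letters
`L : Fin k → U.IdealSheafData` with pointwise INDEX-labelled rsop data, exponent rows `a : Fin s → Fin k → ℕ` (`s ≠ 0`) and the equation
`K = ⨆ t, ∏ j, L j ^ a t j` give the binders of `carrierGameLift` / `monomialPatchLift`: a duplicate-free snc list `𝓛` (the distinct non-unit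
letters), a non-empty exponent table `𝒦` on `𝓛` (row `t` gives letter `T` the exponent `Σ_{j : L j = T} a t j`) and `K = monomialSum 𝒦`; moreover
every member of `𝓛` is a non-unit letter `L j` and every non-unit letter is a member. [cite: BierstoneGrigorievMilmanWlodarczyk2011, §4 Step 2]
[cite: Kollar2007, (3.111) Step 3] -/
theorem exists_letterPatch_monomialSum {k s : ℕ} (L : Fin k → U.IdealSheafData)
    (hlab : ∀ x : U, ∃ (m : ℕ) (z : Fin m → U.presheaf.stalk x), IsRsopPart z ∧
      ∃ ι : {j : Fin k // x ∈ (L j).support} → Fin m, Function.Injective ι ∧ ∀ j, stalkIdeal (L j.1) x = Ideal.span {z (ι j)})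
    (a : Fin s → Fin k → ℕ) (hs : s ≠ 0) {K : U.IdealSheafData} (hK : K = ⨆ t, ∏ j, L j ^ a t j) :
    ∃ (𝓛 : List U.IdealSheafData) (𝒦 : List (List (U.IdealSheafData × ℕ))),
      HasSNC 𝓛 ∧ 𝓛.Nodup ∧ 𝒦 ≠ [] ∧ (∀ A ∈ 𝒦, boundaryOf A = 𝓛) ∧ K = DepthTargets.monomialSum 𝒦 ∧
      (∀ T ∈ 𝓛, T ≠ ⊤ ∧ ∃ j, L j = T) ∧ (∀ j, L j ≠ ⊤ → L j ∈ 𝓛) := by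
  classical
  -- the distinct non-unit letters
  set 𝓛 : List U.IdealSheafData := ((Finset.univ.image L).erase ⊤).toList with h𝓛
  have hmem𝓛 : ∀ T, T ∈ 𝓛 ↔ T ≠ ⊤ ∧ ∃ j, L j = T := fun T => by
    rw [h𝓛, Finset.mem_toList, Finset.mem_erase, Finset.mem_image]
    exact ⟨fun ⟨h1, j, _, hj⟩ => ⟨h1, j, hj⟩, fun ⟨h1, j, hj⟩ => ⟨h1, j, Finset.mem_univ j, hj⟩⟩
  -- the exponent of letter `T` in row `t`
  let c : Fin s → U.IdealSheafData → ℕ := fun t T => ∑ j ∈ Finset.univ.filter (fun j => L j = T), a t j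
  refine ⟨𝓛, List.ofFn fun t => 𝓛.map fun T => (T, c t T), ?_, Finset.nodup_toList _, fun he => hs (List.ofFn_eq_nil_iff.mp he),
    fun A hA => ?_, ?_, fun T hT => (hmem𝓛 T).mp hT, fun j hj => (hmem𝓛 (L j)).mpr ⟨hj, j, rfl⟩⟩
  · -- snc: every member is one of the letters
    exact (hasSNC_ofFn_of_isRsopPart_labels L hlab).of_subset fun T hT => by
      obtain ⟨-, j, hj⟩ := (hmem𝓛 T).mp hT
      exact List.mem_ofFn.mpr ⟨j, hj⟩
  · -- every row lives on `𝓛`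
    obtain ⟨t, rfl⟩ := List.mem_ofFn.mp hA
    simp [boundaryOf, List.map_map, Function.comp_def]
  · -- the equation
    rw [monomialSum_ofFn, hK]
    refine iSup_congr fun t => ?_
    have h1 : monomialIdeal (𝓛.map fun T => (T, c t T)) = ∏ T ∈ 𝓛.toFinset, T ^ c t T := by
      rw [monomialIdeal, List.map_map, List.prod_toFinset _ (Finset.nodup_toList _)]
      rfl
    rw [h1, h𝓛, Finset.toList_toFinset]
    exact prod_pow_eq_prod_image_erase_top L (a t)

end Summit.ResolutionOfSingularities.ResolutionOfSingularities.Theorems.DepthMultiHost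

end
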